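/-
Origin: expansion seat `planner-pub-hodgecm-qw8b-g3-0`, handover #1 2026-08-18T06:32:23Z (`HOME/pub-hodgecm-qw8b-g3/lean/Qw8b3/DegreeZeroDescent.lean`, md5 a97ec26b, 162 lines);
landed by the gen-7 packager in gate run 25 as `HodgeCM/Proofs/Pohlmann/DegreeZeroDescent.lean` (verbatim).
-/
/-
Origin: pub-hodgecm-qw8b-g3 (QW8 seat 2, gen 3; planner-pub-hodgecm-qw8b-g3-0), 2026-08-18.
Intended target `HodgeCM/Proofs/Pohlmann/DegreeZeroDescent.lean`, module `HodgeCM.Proofs.Pohlmann.DegreeZeroDescent`.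
ADDITIVE leaf over two RUN-24 modules: `HodgeCM.Proofs.Pohlmann.DegreeZeroGeneric` (pohl-g6) and
`HodgeCM.StubTree.Qw8GysinDescent` (qw8-g4).  No new inputs and no new axioms.
-/
import Summits.HodgeConjecture.HodgeCM.Proofs.Pohlmann.DegreeZeroGeneric
import Summits.HodgeConjecture.HodgeCM.StubTree.Qw8GysinDescent

/-!
# Degree zero over the RUN-24 binder list: `dim H⁰(A′) ≤ 1` from F7d, with no trace, no F6, no F7

`Proofs/Pohlmann/DegreeZeroGeneric.lean` (pohl-g6) derives `dim_ℚ H⁰(A′, ℚ) ≤ 1` for the CM products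
`A′ = ∏_{j ≤ n} A_{(F,Θ_j)}` from `ModelAxioms` + N1 + N3 + F7 `Fact_gysin` + `Fact_trTopCM`
(`finrank_coh_zero_cmProd_le_one_generic`).  `Fact_trTopCM` is the one input of that cone which FAILS in every
exterior toy model (`Model/Toy/ToyTrTop.lean`), so the cone has no joint consistency witness.  At run 24 the
[QW8]-side end state `Assembly.COR_CM_of_descentFacts` replaced F7 + `Fact_trTopCM` by qw8-g4's trace-free
**F7d `Fact_gysinDescent`** (+ `Fact_dimProd`), a list with ONE model of all its generic binders
(`HodgeCM.Toy.descentFacts_consistent`).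

This file re-runs pohl-g6's `Z`-construction over that list.  For a block configuration `Ξ = (Θ, Θ_0)` with
single-factor second block `Y' = A_{(F,Θ_0)}`, the linear map `Z : x ↦ p_Y^* x ∪ p_{Y'}^* ω` (`ω` the top
eigen-monomial of `Y'`) sends `H⁰(Y, ℂ)` into the weight space of weight `((∅)_j, univ)` and degree `2 dim Y' > 0`
of `P = Y × Y'`, a space of dimension `≤ 1` (`finrank_weightSpace_le_one`); `Z` is INJECTIVE by clause (a) of F7d,
complexified (`Universe.boxC_eq_zero`, qw8-g4) — where pohl-g6 used the projection formula `p_{Y*}(Z x) = (∫ω) · x`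
of F7 and `∫ ω ≠ 0` of `Fact_trTopCM` — and `ω ≠ 0` is the theorem `fmono_ne_zero` (N1 + M22).  Hence:

* `finrank_coh_zero_cmProd_le_one_of_descent` — `dim_ℚ H⁰(A′, ℚ) ≤ 1` from `ModelAxioms` + N1 + N3 +
  `Fact_dimProd` + F7d;
* `cmProdConnected_iff_h0Nontrivial_of_descent` — under these, `CMProdConnected ↔ CMProdH0Nontrivial`
  (exactly the non-vanishing `H⁰(A′, ℚ) ≠ 0` is left, as in pohl-g6);
* `pohlmannTheorem31All_of_descentFacts` — Gao–Ullmo Thm 3.1 "(Pohlmann)", EVERY `p ≥ 0`, from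
  `ModelAxioms` + N1–N4 + `Fact_dimProd` + F7d + `CMProdH0Nontrivial`.

Every generic hypothesis here (all but `CMProdH0Nontrivial`, which also holds in the toy: `Toy.finrank_coh_zero`)
is among the binders of `Assembly.COR_CM_of_descentFacts`; nothing is cited, nothing is assumed beyond them.
-/

noncomputable section

open scoped TensorProduct NumberField

namespace HodgeCM

namespace Universe

open Literature.AlgebraicGeometry.Motives (CMType)

variable {U : Universe}

section Descent

variable {F : CMField} {n : ℕ}

/-- `dim_ℂ H⁰(Y, ℂ) ≤ 1` for the FIRST BLOCK `Y = ∏_{j ≤ n} A_{Ξ_j}` of a block configuration `Ξ = (Θ, Θ')` with a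
single-factor second block (`ModelAxioms` + N1 + N3 + `Fact_dimProd` + F7d): pohl-g6's `finrank_cohC_zero_blkA_le_one`
with the injectivity of `Z : x ↦ p_Y^* x ∪ p_{Y'}^* ω` supplied by F7d (a) (`boxC_eq_zero`) instead of F7 + `Fact_trTopCM`. -/
theorem finrank_cohC_zero_blkA_le_one_of_descent (M : U.ModelAxioms) (hN1 : U.Fact_cupExterior)
    (hN3 : U.Fact_pull_H0) (hd : U.Fact_dimProd) (h7d : U.Fact_gysinDescent)
    (Ξ : Fin (n + 1 + (0 + 1)) → CMType F) :
    Module.finrank ℂ (U.CohC (U.cmProd F (blkA Ξ)) 0) ≤ 1 := by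
  classical
  obtain ⟨pA, pB, hP⟩ := U.blockPair_exists M.pull_id M.pull_comp M.lift F n 0 Ξ
  -- the top eigen-monomial `ω` of the single factor `Y' = A_{Ξ (last)}`
  obtain ⟨β, -, hβ⟩ := exists_integral_injective_eval F
  choose xB hxB _hx0 hsp using fun i => exists_eigenbasis M F (blkB Ξ i) β hβ
  have h2d : 2 * U.dim (U.cmProd F (blkB Ξ)) = Module.finrank ℚ F := by
    rw [← two_mul_halfDegree F]
    exact congrArg (2 * ·) (M.cmAV F (blkB Ξ 0)).2.2
  have hdpos : 0 < U.dim (U.cmProd F (blkB Ξ)) := by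
    have hF : 0 < Module.finrank ℚ F := Module.finrank_pos
    omega
  obtain ⟨K, hK⟩ : ∃ K, 2 * U.dim (U.cmProd F (blkB Ξ)) = K + 1 := ⟨2 * U.dim (U.cmProd F (blkB Ξ)) - 1, by omega⟩
  have hcard : Fintype.card (Fin (0 + 1) × ((F : Type) →+* ℂ)) = K + 1 := by
    rw [card_index]; simp only [zero_add, one_mul]; omega
  let q : Fin (K + 1) → Fin (0 + 1) × ((F : Type) →+* ℂ) := fun t => (Fintype.equivFin _).symm (finCongr hcard.symm t)
  have hqb : Function.Bijective q := (Fintype.equivFin _).symm.bijective.comp (finCongr hcard.symm).bijective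
  let ω : U.CohC (U.cmProd F (blkB Ξ)) (2 * U.dim (U.cmProd F (blkB Ξ))) := U.castC _ hK.symm (U.fmono xB K q)
  -- `ω ≠ 0` is a THEOREM (N1 + M22): no trace needed
  have hω0 : ω ≠ 0 :=
    (LinearEquiv.map_ne_zero_iff _).mpr (U.fmono_ne_zero xB M hN1 hxB hsp hqb.1)
  have hωw : U.IsWeightVector F (blkB Ξ) (fun _ => Finset.univ) (2 * U.dim (U.cmProd F (blkB Ξ))) ω := by
    have h := isWeightVector_fmono xB M hxB K q hqb.1
    rw [wtOf_eq_univ_of_surjective hqb.2] at h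
    exact U.isWeightVector_castC F (blkB Ξ) _ hK.symm h
  -- `Z : x ↦ p_Y^* x ∪ p_{Y'}^* ω`
  let Z : U.CohC (U.cmProd F (blkA Ξ)) (2 * 0) →ₗ[ℂ]
      U.CohC (U.cmProd F Ξ) (2 * 0 + 2 * U.dim (U.cmProd F (blkB Ξ))) :=
    (U.cupC (U.cmProd F Ξ) (2 * 0) (2 * U.dim (U.cmProd F (blkB Ξ)))).flip
        (U.pullC pB (2 * U.dim (U.cmProd F (blkB Ξ))) ω) ∘ₗ U.pullC pA (2 * 0)
  have hZapply : ∀ x, Z x = U.cupC (U.cmProd F Ξ) (2 * 0) (2 * U.dim (U.cmProd F (blkB Ξ))) (U.pullC pA (2 * 0) x)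
      (U.pullC pB (2 * U.dim (U.cmProd F (blkB Ξ))) ω) := fun _ => rfl
  -- injective, by clause (a) of F7d (complexified: `boxC_eq_zero`)
  have hZinj : Function.Injective Z := by
    refine (injective_iff_map_eq_zero Z).2 fun x hx => ?_
    exact U.boxC_eq_zero Ξ M hN1 hd h7d hP hω0 ((hZapply x).symm.trans hx)
  -- with values in the weight space of weight `((∅)_j, univ)`, of positive degree
  let S : Fin (n + 1 + (0 + 1)) → Finset ((F : Type) →+* ℂ) :=
    Fin.append (fun _ : Fin (n + 1) => (∅ : Finset ((F : Type) →+* ℂ))) (fun _ : Fin (0 + 1) => Finset.univ)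
  have hZmem : ∀ x, Z x ∈ U.weightSpace F Ξ S (2 * 0 + 2 * U.dim (U.cmProd F (blkB Ξ))) := fun x => by
    rw [mem_weightSpace_iff, hZapply]
    have hxw0 : U.IsWeightVector F Ξ (fun _ => ∅) (2 * 0) (U.pullC pA (2 * 0) x) := isWeightVector_zero hN3 _
    have h := U.isWeightVector_cupC_of_disjoint M.pull_cup (S := fun _ => ∅) (S' := S)
      (fun _ => Finset.disjoint_empty_left _) hxw0 (U.isWeightVector_pullC_blkB Ξ M hN1 hP (by omega) hωw)
    simpa only [Finset.empty_union] using h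
  have hZinj' : Function.Injective (Z.codRestrict _ hZmem) := fun a b h =>
    hZinj (congrArg Subtype.val h :)
  calc Module.finrank ℂ (U.CohC (U.cmProd F (blkA Ξ)) 0)
      = Module.finrank ℂ (U.CohC (U.cmProd F (blkA Ξ)) (2 * 0)) := rfl
    _ ≤ Module.finrank ℂ (U.weightSpace F Ξ S (2 * 0 + 2 * U.dim (U.cmProd F (blkB Ξ)))) :=
        LinearMap.finrank_le_finrank_of_injective hZinj'
    _ ≤ 1 := finrank_weightSpace_le_one M hN1 (by omega) S

variable {Θ : Fin (n + 1) → CMType F}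

/-- **`dim_ℂ H⁰(A′, ℂ) ≤ 1` over the run-24 list** (`ModelAxioms` + N1 + N3 + `Fact_dimProd` + F7d), for
`A′ = ∏_{j ≤ n} A_{(F,Θ_j)}`: the block statement for `Ξ = (Θ, Θ_0)`, transported along `blkA (Θ, Θ_0) = Θ`. -/
theorem finrank_cohC_zero_le_one_of_descent (M : U.ModelAxioms) (hN1 : U.Fact_cupExterior) (hN3 : U.Fact_pull_H0)
    (hd : U.Fact_dimProd) (h7d : U.Fact_gysinDescent) : Module.finrank ℂ (U.CohC (U.cmProd F Θ) 0) ≤ 1 := by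
  have h := finrank_cohC_zero_blkA_le_one_of_descent M hN1 hN3 hd h7d (Fin.append Θ (fun _ : Fin (0 + 1) => Θ 0))
  rwa [blkA_append] at h

/-- **`dim_ℚ H⁰(A′, ℚ) ≤ 1` over the run-24 list** (no F6, no F7, no trace). -/
theorem finrank_coh_zero_cmProd_le_one_of_descent (M : U.ModelAxioms) (hN1 : U.Fact_cupExterior)
    (hN3 : U.Fact_pull_H0) (hd : U.Fact_dimProd) (h7d : U.Fact_gysinDescent) :
    Module.finrank ℚ (U.Coh (U.cmProd F Θ) 0) ≤ 1 := by
  have h := finrank_cohC_zero_le_one_of_descent (F := F) (Θ := Θ) M hN1 hN3 hd h7d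
  rwa [Module.finrank_baseChange] at h

/-- `dim_ℚ H⁰(A′, ℚ) = 1` over the run-24 list AND `H⁰(A′, ℚ) ≠ 0`. -/
theorem finrank_coh_zero_cmProd_of_descent (M : U.ModelAxioms) (hN1 : U.Fact_cupExterior) (hN3 : U.Fact_pull_H0)
    (hd : U.Fact_dimProd) (h7d : U.Fact_gysinDescent) (hnt : U.CMProdH0Nontrivial) :
    Module.finrank ℚ (U.Coh (U.cmProd F Θ) 0) = 1 := by
  haveI := hnt F n Θ
  exact le_antisymm (finrank_coh_zero_cmProd_le_one_of_descent M hN1 hN3 hd h7d) Module.finrank_pos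

end Descent

/-- **`CMProdConnected` over the run-24 list + the degree-`0` residual `CMProdH0Nontrivial`.** -/
theorem cmProdConnected_of_descent (M : U.ModelAxioms) (hN1 : U.Fact_cupExterior) (hN3 : U.Fact_pull_H0)
    (hd : U.Fact_dimProd) (h7d : U.Fact_gysinDescent) (hnt : U.CMProdH0Nontrivial) : U.CMProdConnected :=
  fun _F _n _Θ => finrank_coh_zero_cmProd_of_descent M hN1 hN3 hd h7d hnt

/-- Over the run-24 list, **`CMProdConnected ↔ CMProdH0Nontrivial`**. -/
theorem cmProdConnected_iff_h0Nontrivial_of_descent (M : U.ModelAxioms) (hN1 : U.Fact_cupExterior)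
    (hN3 : U.Fact_pull_H0) (hd : U.Fact_dimProd) (h7d : U.Fact_gysinDescent) :
    U.CMProdConnected ↔ U.CMProdH0Nontrivial :=
  ⟨cmProdH0Nontrivial_of_connected, cmProdConnected_of_descent M hN1 hN3 hd h7d⟩

/-- **Gao–Ullmo Thm 3.1 "(Pohlmann)", both sentences, EVERY `p ≥ 0`, from `ModelAxioms` + N1–N4 + `Fact_dimProd` +
F7d + `CMProdH0Nontrivial`** — the Pohlmann side over the SAME generic binders as the run-24 [QW8]-side end state
`Assembly.COR_CM_of_descentFacts`, plus the degree-`0` residual. -/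
theorem pohlmannTheorem31All_of_descentFacts (M : U.ModelAxioms) (hN1 : U.Fact_cupExterior)
    (hN2 : U.Fact_cup_hodge) (hN3 : U.Fact_pull_H0) (hN4 : U.Fact_hodge_F0) (hd : U.Fact_dimProd)
    (h7d : U.Fact_gysinDescent) (hnt : U.CMProdH0Nontrivial) : U.PohlmannTheorem31All :=
  pohlmannTheorem31All_of_connected M hN1 hN2 hN3 hN4 (cmProdConnected_of_descent M hN1 hN3 hd h7d hnt)

end Universe

end HodgeCM

end
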